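import Literature.Geometry.Kaehler.ComplexTorusGaloisCMTypeFamiliesIsogenyClasses
import Literature.Geometry.Kaehler.ComplexTorusCyclotomicAutomorphismOrderEightTwelve
import Literature.Geometry.Kaehler.ComplexTorusCyclotomicAutomorphismPrimePowerOrder
import Literature.AlgebraicGeometry.ComplexMultiplication.ShimuraCyclotomicCMTypeCensus
import Literature.NumberTheory.NumberFields.CyclotomicFieldsEightSixteenClassNumber
import Literature.NumberTheory.NumberFields.CyclotomicFieldTwelveClassNumber
import HarnessLib

/-!
# Complex `2`-tori with an automorphism of order `8`, or with an endomorphism of characteristic polynomial `Φ₁₂`: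
# EXACTLY TWO of each, up to isomorphism — non-isogenous, each isogenous to the square of a CM elliptic curve

Layer `Literature/Geometry/Kaehler`, namespace `Literature.Geometry.Kaehler.ComplexTorus`; lane `lit-hodgefound` (Track 2
foundations library), prover seat `lit-hodgefound-p10`, generation 33, row «A2-26(gx)» (self-proposed 2026-08-28).  Theorems
only; no `def`, no instance, no named fact (net Literature debt 0).  Sequel of generation 32's
`ComplexTorusCyclotomicAutomorphismOrderEightTwelve` (a `2`-torus with an endomorphism of order `8`, or of characteristic
polynomial `Φ₁₂`, is NOT simple and is `∼ E²`) — here the ISOMORPHISM classes are counted: `h(ℚ(ζ₈)) = h(ℚ(ζ₁₂)) = 1`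
(`CyclotomicFieldsEightSixteenClassNumber`, `CyclotomicFieldTwelveClassNumber`), so by this generation's
`ComplexTorusGaloisCMTypeFamiliesIsogenyClasses` `ℂ²/Φ(𝔞) ≅ ℂ²/Ψ(𝔟) ⟺ ℂ²/Φ(𝔞) ∼ ℂ²/Ψ(𝔟) ⟺ Φ, Ψ in one family`, and the
families of the biquadratic fields `ℚ(ζ₈) = ℚ(i, √2)`, `ℚ(ζ₁₂) = ℚ(i, √3)` are read on residues (Shimura §8.4 (2)(A); p29's
dictionary, kernel `decide` on `ℤ/8`, `ℤ/12`):

* `ℚ(ζ₈)`: `(ℤ/8)ˣ = {1, 3, 5, 7}`, four types `{1,3}`, `{5,7}` (stable under `3`: induced from `ℚ(√−2)`, the fixed field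
  of `σ₃`) and `{1,5}`, `{3,7}` (stable under `5`: induced from `ℚ(i)`, fixed by `σ₅`) — TWO families of two;
* `ℚ(ζ₁₂)`: `(ℤ/12)ˣ = {1, 5, 7, 11}`, four types `{1,5}`, `{7,11}` (stable under `5`: induced from `ℚ(i) = ℚ(ζ₁₂³)`) and
  `{1,7}`, `{5,11}` (stable under `7`: induced from `ℚ(√−3) = ℚ(ζ₁₂⁴)`) — TWO families of two.

Hence: §1 the residue censuses (`card_allCMResidueSets_and_filter_eight/twelve`, `forall_exists_pullback_iff_eight/twelve`,
`reps_…`, `forall_exists_pullback_rep_…`); §2 the types and models (`natCard_cmType_and_not_isPrimitive_…`,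
**`stable_iff_not_stable_…`** (each type is induced from exactly one of the two imaginary quadratic subfields),
**`isAutTransform_iff_…`**, **`exists_two_families_…`**, **`isIsomorphic_periodIso_iff_isAutTransform_…`** /
`…_iff_isIsogenous_…`, **`exists_two_models_…`**); §3 the pairs `(X, u)`: **`isIsomorphic_iff_isIsogenous_of_orderOf_eq_eight`**,
**`exists_two_forall_isIsomorphic_of_orderOf_eq_eight`** (EXACTLY TWO complex `2`-tori admit an automorphism of order `8`,
non-isogenous), **`isIsomorphic_iff_isIsogenous_of_charpoly_eq_cyclotomic_twelve`**,
**`exists_two_forall_isIsomorphic_of_charpoly_eq_cyclotomic_twelve`** (EXACTLY TWO complex tori admit an endomorphism of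
characteristic polynomial `Φ₁₂`; order `12` alone does not force `Φ₁₂` on a `2`-torus: `Φ₃Φ₄` has order `12` too).

## References

* [Shimura1998] G. Shimura, *Abelian Varieties with Complex Multiplication and Modular Functions* (1998), §6.1 Thm. 2
  p. 41, §6.2 Thm. 3 p. 42, §7.4 Prop. 17 p. 58, §8.2 Prop. 26 p. 69, §8.4 Example (2)(A) p. 64.
* [Fujiki1988] A. Fujiki, *Finite automorphism groups of complex tori of dimension two*, Publ. RIMS 24 (1988), Thm. 4.1 and
  Table 6, pp. 45–46.
* [BirkenhakeLange2004] Ch. Birkenhake, H. Lange, *Complex Abelian Varieties*, 2nd ed. (2004), §13.3.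
* [Washington1997] L. C. Washington, *Introduction to Cyclotomic Fields*, 2nd ed. (1997), Thm. 2.5, Thm. 11.1.
-/

noncomputable section

open scoped Classical nonZeroDivisors NumberField Manifold ContDiff MatrixGroups
open NumberField Module Polynomial

namespace Literature.Geometry.Kaehler

namespace ComplexTorus

-- `open scoped`: the tree's action of `Aut(ℂ)` on `Hom(K, ℂ)` by composition (`ringEquivCompAction`) is a scoped instance
open scoped Literature.NumberTheory.ComplexMultiplication
open Literature.AlgebraicGeometry.Motives (CMType)
open Literature.NumberTheory.ComplexMultiplication (IsPrimitive)
open Literature.NumberTheory.ComplexMultiplication.CMTypeLattice (periodIso)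
open Literature.AlgebraicGeometry.ComplexMultiplication.CyclotomicCMTypeResidueSets (IsAutTransform unitResidues residueSet
  pullback allCMResidueSets IsCMResidueSet HasTrivialStabilizer isCMResidueSet_residueSet residueSet_subset_unitResidues
  forall_mem_iff_iff_eq_pullback isPrimitive_iff_hasTrivialStabilizer isAutTransform_iff_exists_eq_pullback
  residueSet_cmTypeOfResidues)
open Literature.AlgebraicGeometry.Pohlmann1968.Cyclotomic (cmTypeOfResidues finrank_eq_totient)
open Literature.NumberTheory.NumberFields (classNumber_eq_one_of_isCyclotomicExtension_eight
  isPrincipalIdealRing_ringOfIntegers_cyclotomicField_eight classNumber_eq_one_of_isCyclotomicExtension_twelve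
  isPrincipalIdealRing_ringOfIntegers_cyclotomicField_twelve)
-- `CMTypeLattice.mulMatrix I a` is spelled with its namespace below (the elliptic files declare `ComplexTorus.mulMatrix`).
open Literature.NumberTheory.ComplexMultiplication (CMTypeLattice.mulMatrix)

/-- `allCMResidueSets N` enumerates exactly the CM residue sets (p29's enumeration, membership unfolded).
[cite: Shimura1998, §8.4 Example (1)] -/
private theorem mem_allCMResidueSets_iff₃₉ {N : ℕ} [NeZero N] (S : Finset (ZMod N)) :
    S ∈ allCMResidueSets N ↔ IsCMResidueSet N S := by
  rw [allCMResidueSets, Finset.mem_filter, Finset.mem_powerset]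
  exact ⟨fun h => h.2, fun h => ⟨h.1, h⟩⟩

/-! ### §1.1 The census of `ℚ(ζ₈)` on residues: four types, TWO families (`W = {1,3}` ↔ `ℚ(√−2)`, `W = {1,5}` ↔ `ℚ(i)`) -/

/-- **`ℤ/8` has `2² = 4` CM residue sets**, each stable under EXACTLY ONE of `3`, `5` (no set violates it): every CM type
of the biquadratic `ℚ(ζ₈)` is induced from `ℚ(√−2)` (fixed by `σ₃`) or from `ℚ(i)` (fixed by `σ₅`), never both, and none is
primitive. [cite: Shimura1998, §8.4 Example (2)(A), p. 64] -/
theorem card_allCMResidueSets_and_filter_eight :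
    (allCMResidueSets 8).card = 4 ∧
    ((allCMResidueSets 8).filter fun S => ¬(pullback 8 3 S = S ↔ ¬pullback 8 5 S = S)).card = 0 ∧
    ((allCMResidueSets 8).filter fun S => HasTrivialStabilizer 8 S).card = 0 := by
  refine ⟨?_, ?_, ?_⟩ <;> decide +kernel

/-- The families on residues, counting form over the `4 × 4` pairs: no pair violates «unit translates iff both or neither
are stable under `3`». [cite: Shimura1998, §8.4 Examples (1)–(2), p. 65] -/
private theorem card_filter_prod_eight :
    ((allCMResidueSets 8 ×ˢ allCMResidueSets 8).filter fun p =>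
        ¬((∃ d ∈ unitResidues 8, p.2 = pullback 8 d p.1) ↔
          (pullback 8 3 p.1 = p.1 ↔ pullback 8 3 p.2 = p.2))).card = 0 := by
  decide +kernel

/-- **The families on residues, `N = 8`: two CM residue sets are unit translates iff both or neither are stable under `3`.**
[cite: Shimura1998, §8.4 Examples (1)–(2), p. 65] -/
theorem forall_exists_pullback_iff_eight :
    ∀ S ∈ allCMResidueSets 8, ∀ S' ∈ allCMResidueSets 8,
      (∃ d ∈ unitResidues 8, S' = pullback 8 d S) ↔ (pullback 8 3 S = S ↔ pullback 8 3 S' = S') := by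
  intro S hS S' hS'
  exact not_not.1 (Finset.filter_eq_empty_iff.1 (Finset.card_eq_zero.1 card_filter_prod_eight) (Finset.mk_mem_product hS hS'))

/-- **The two representatives** `{1, 3}` (stable under `3`) and `{1, 5}` (stable under `5`) are CM residue sets of `ℤ/8`, in
different `(ℤ/8)ˣ`-orbits. [cite: Shimura1998, §8.4 Example (2)(A), p. 64] -/
theorem reps_eight :
    IsCMResidueSet 8 ({1, 3} : Finset (ZMod 8)) ∧ IsCMResidueSet 8 ({1, 5} : Finset (ZMod 8)) ∧
      pullback 8 3 ({1, 3} : Finset (ZMod 8)) = {1, 3} ∧ pullback 8 5 ({1, 5} : Finset (ZMod 8)) = {1, 5} ∧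
      ¬∃ d ∈ unitResidues 8, ({1, 5} : Finset (ZMod 8)) = pullback 8 d ({1, 3} : Finset (ZMod 8)) := by
  refine ⟨?_, ?_, ?_, ?_, ?_⟩ <;> decide +kernel

/-- Counting form: no CM residue set of `ℤ/8` fails to be a translate of `{1, 3}` or of `{1, 5}`. [cite: Shimura1998, §8.4 Example (2)(A), p. 64] -/
private theorem card_filter_not_exists_pullback_rep_eight :
    ((allCMResidueSets 8).filter fun S =>
      ¬((∃ d ∈ unitResidues 8, S = pullback 8 d ({1, 3} : Finset (ZMod 8))) ∨
        (∃ d ∈ unitResidues 8, S = pullback 8 d ({1, 5} : Finset (ZMod 8))))).card = 0 := by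
  decide +kernel

/-- **Every CM residue set of `ℤ/8` is a unit translate of `{1, 3}` or of `{1, 5}`** (two orbits of two).
[cite: Shimura1998, §8.4 Example (2)(A), p. 64] -/
theorem forall_exists_pullback_rep_eight :
    ∀ S ∈ allCMResidueSets 8,
      (∃ d ∈ unitResidues 8, S = pullback 8 d ({1, 3} : Finset (ZMod 8))) ∨
      (∃ d ∈ unitResidues 8, S = pullback 8 d ({1, 5} : Finset (ZMod 8))) := by
  intro S hS
  exact not_not.1 (Finset.filter_eq_empty_iff.1 (Finset.card_eq_zero.1 card_filter_not_exists_pullback_rep_eight) hS)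

/-! ### §1.2 The census of `ℚ(ζ₁₂)` on residues: four types, TWO families (`W = {1,5}` ↔ `ℚ(i)`, `W = {1,7}` ↔ `ℚ(√−3)`) -/

/-- **`ℤ/12` has `2² = 4` CM residue sets**, each stable under EXACTLY ONE of `5`, `7` (no set violates it): every CM type
of the biquadratic `ℚ(ζ₁₂)` is induced from `ℚ(i)` (fixed by `σ₅`) or from `ℚ(√−3)` (fixed by `σ₇`), never both, and none is
primitive. [cite: Shimura1998, §8.4 Example (2)(A), p. 64] -/
theorem card_allCMResidueSets_and_filter_twelve :
    (allCMResidueSets 12).card = 4 ∧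
    ((allCMResidueSets 12).filter fun S => ¬(pullback 12 5 S = S ↔ ¬pullback 12 7 S = S)).card = 0 ∧
    ((allCMResidueSets 12).filter fun S => HasTrivialStabilizer 12 S).card = 0 := by
  refine ⟨?_, ?_, ?_⟩ <;> decide +kernel

/-- The families on residues, counting form over the `4 × 4` pairs: no pair violates «unit translates iff both or neither
are stable under `5`». [cite: Shimura1998, §8.4 Examples (1)–(2), p. 65] -/
private theorem card_filter_prod_twelve :
    ((allCMResidueSets 12 ×ˢ allCMResidueSets 12).filter fun p =>
        ¬((∃ d ∈ unitResidues 12, p.2 = pullback 12 d p.1) ↔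
          (pullback 12 5 p.1 = p.1 ↔ pullback 12 5 p.2 = p.2))).card = 0 := by
  decide +kernel

/-- **The families on residues, `N = 12`: two CM residue sets are unit translates iff both or neither are stable under `5`.**
[cite: Shimura1998, §8.4 Examples (1)–(2), p. 65] -/
theorem forall_exists_pullback_iff_twelve :
    ∀ S ∈ allCMResidueSets 12, ∀ S' ∈ allCMResidueSets 12,
      (∃ d ∈ unitResidues 12, S' = pullback 12 d S) ↔ (pullback 12 5 S = S ↔ pullback 12 5 S' = S') := by
  intro S hS S' hS'
  exact not_not.1 (Finset.filter_eq_empty_iff.1 (Finset.card_eq_zero.1 card_filter_prod_twelve) (Finset.mk_mem_product hS hS'))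

/-- **The two representatives** `{1, 5}` (stable under `5`) and `{1, 7}` (stable under `7`) are CM residue sets of `ℤ/12`, in
different `(ℤ/12)ˣ`-orbits. [cite: Shimura1998, §8.4 Example (2)(A), p. 64] -/
theorem reps_twelve :
    IsCMResidueSet 12 ({1, 5} : Finset (ZMod 12)) ∧ IsCMResidueSet 12 ({1, 7} : Finset (ZMod 12)) ∧
      pullback 12 5 ({1, 5} : Finset (ZMod 12)) = {1, 5} ∧ pullback 12 7 ({1, 7} : Finset (ZMod 12)) = {1, 7} ∧
      ¬∃ d ∈ unitResidues 12, ({1, 7} : Finset (ZMod 12)) = pullback 12 d ({1, 5} : Finset (ZMod 12)) := by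
  refine ⟨?_, ?_, ?_, ?_, ?_⟩ <;> decide +kernel

/-- Counting form: no CM residue set of `ℤ/12` fails to be a translate of `{1, 5}` or of `{1, 7}`. [cite: Shimura1998, §8.4 Example (2)(A), p. 64] -/
private theorem card_filter_not_exists_pullback_rep_twelve :
    ((allCMResidueSets 12).filter fun S =>
      ¬((∃ d ∈ unitResidues 12, S = pullback 12 d ({1, 5} : Finset (ZMod 12))) ∨
        (∃ d ∈ unitResidues 12, S = pullback 12 d ({1, 7} : Finset (ZMod 12))))).card = 0 := by
  decide +kernel

/-- **Every CM residue set of `ℤ/12` is a unit translate of `{1, 5}` or of `{1, 7}`** (two orbits of two).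
[cite: Shimura1998, §8.4 Example (2)(A), p. 64] -/
theorem forall_exists_pullback_rep_twelve :
    ∀ S ∈ allCMResidueSets 12,
      (∃ d ∈ unitResidues 12, S = pullback 12 d ({1, 5} : Finset (ZMod 12))) ∨
      (∃ d ∈ unitResidues 12, S = pullback 12 d ({1, 7} : Finset (ZMod 12))) := by
  intro S hS
  exact not_not.1 (Finset.filter_eq_empty_iff.1 (Finset.card_eq_zero.1 card_filter_not_exists_pullback_rep_twelve) hS)

/-! ### §2.1 The CM types and the models `ℂ²/Φ(𝔞)` of `ℚ(ζ₈)` -/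

section ModelsEight

variable {K : Type} [Field K] [NumberField K] [IsCyclotomicExtension {8} ℚ K]

/-- The residue set of a CM type of `ℚ(ζ₈)` is one of the `4` CM residue sets. [cite: Shimura1998, §8.4 Example (2)(A)] -/
private theorem residueSet_mem₈ (Φ : CMType K) : residueSet 8 Φ ∈ allCMResidueSets 8 :=
  (mem_allCMResidueSets_iff₃₉ _).2 (isCMResidueSet_residueSet 8 Φ)

/-- «`S_Φ` stable under `t`» in the membership spelling is `S_Φ·t⁻¹ = S_Φ`. [cite: Shimura1998, §8.4 Example (1)] -/
private theorem stable_iff_pullback_eq₈ (Φ : CMType K) (t : ZMod 8) :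
    (∀ c ∈ unitResidues 8, (c * t ∈ residueSet 8 Φ ↔ c ∈ residueSet 8 Φ)) ↔
      pullback 8 t (residueSet 8 Φ) = residueSet 8 Φ := by
  rw [eq_comm, ← forall_mem_iff_iff_eq_pullback (residueSet_subset_unitResidues 8 Φ) t]
  exact forall₂_congr fun c _ => Iff.comm

/-- The CM type with a prescribed CM residue set. [cite: Shimura1998, §8.4 Example (1)] -/
private theorem exists_residueSet_eq₈ {S : Finset (ZMod 8)} (hS : IsCMResidueSet 8 S) :
    ∃ Φ : CMType K, residueSet 8 Φ = S :=
  ⟨cmTypeOfResidues (L := K) S hS.cm, residueSet_cmTypeOfResidues 8 hS _⟩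

omit [IsCyclotomicExtension {8} ℚ K] in
/-- **`ℚ(ζ₈)` has `2² = 4` CM types, NONE of them primitive.** [cite: Shimura1998, §8.4 Example (2)(A), p. 64] -/
theorem natCard_cmType_and_not_isPrimitive_eight (hK : IsCyclotomicExtension {8} ℚ K) (φ₀ : K →+* ℂ) :
    Nat.card (CMType K) = 4 ∧ ∀ Φ : CMType K, ¬ IsPrimitive (ℂ ≃+* ℂ) Φ.1 φ₀ := by
  haveI : IsCMField K := IsCyclotomicExtension.Rat.isCMField K (S := ({8} : Set ℕ)) ⟨8, rfl, by norm_num⟩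
  refine ⟨by rw [Literature.NumberTheory.ComplexMultiplication.CMTypeCount.natCard_cmType, finrank_eq_totient 8 K]; decide, fun Φ h ↦ ?_⟩
  have h0 := Finset.filter_eq_empty_iff.1 (Finset.card_eq_zero.1 card_allCMResidueSets_and_filter_eight.2.2)
    (residueSet_mem₈ Φ)
  exact h0 ((isPrimitive_iff_hasTrivialStabilizer 8 Φ φ₀).1 h)

/-- **Every CM type of `ℚ(ζ₈)` is induced from EXACTLY ONE of `ℚ(√−2)`, `ℚ(i)`**: its residue set is stable under `3`
iff it is not stable under `5`. [cite: Shimura1998, §8.4 Example (2)(A), p. 64] -/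
theorem stable_iff_not_stable_eight (Φ : CMType K) :
    (∀ c ∈ unitResidues 8, (c * 3 ∈ residueSet 8 Φ ↔ c ∈ residueSet 8 Φ)) ↔
      ¬(∀ c ∈ unitResidues 8, (c * 5 ∈ residueSet 8 Φ ↔ c ∈ residueSet 8 Φ)) := by
  have h := Finset.filter_eq_empty_iff.1 (Finset.card_eq_zero.1 card_allCMResidueSets_and_filter_eight.2.1)
    (residueSet_mem₈ Φ)
  rw [not_not, ← stable_iff_pullback_eq₈, ← stable_iff_pullback_eq₈] at h
  exact h

/-- **THE FAMILIES OF `ℚ(ζ₈)`**: two CM types are transformed onto each other by an automorphism iff both or neither are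
induced from `ℚ(√−2)` (residue sets both or neither stable under `3`). [cite: Shimura1998, §8.4 Examples (1)–(2), p. 65] -/
theorem isAutTransform_iff_eight (Φ Ψ : CMType K) :
    IsAutTransform Φ Ψ ↔
      ((∀ c ∈ unitResidues 8, (c * 3 ∈ residueSet 8 Φ ↔ c ∈ residueSet 8 Φ)) ↔
        (∀ c ∈ unitResidues 8, (c * 3 ∈ residueSet 8 Ψ ↔ c ∈ residueSet 8 Ψ))) := by
  rw [isAutTransform_iff_exists_eq_pullback 8 Φ Ψ,
    forall_exists_pullback_iff_eight _ (residueSet_mem₈ Φ) _ (residueSet_mem₈ Ψ),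
    stable_iff_pullback_eq₈, stable_iff_pullback_eq₈]

omit [IsCyclotomicExtension {8} ℚ K] in
/-- **THE TWO FAMILIES OF CM TYPES OF `ℚ(ζ₈)`, EXPLICITLY**: types `Φ₁`, `Φ₂` with residue sets `{1, 3}` (stable under `3`:
induced from `ℚ(√−2)`) and `{1, 5}` (stable under `5`: from `ℚ(i)`), not transformed onto each other, every type a transform
of one of them. [cite: Shimura1998, §8.4 Example (2)(A), p. 64] -/
theorem exists_two_families_eight (hK : IsCyclotomicExtension {8} ℚ K) :
    ∃ Φ₁ Φ₂ : CMType K, residueSet 8 Φ₁ = {1, 3} ∧ residueSet 8 Φ₂ = {1, 5} ∧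
      (∀ c ∈ unitResidues 8, (c * 3 ∈ residueSet 8 Φ₁ ↔ c ∈ residueSet 8 Φ₁)) ∧
      (∀ c ∈ unitResidues 8, (c * 5 ∈ residueSet 8 Φ₂ ↔ c ∈ residueSet 8 Φ₂)) ∧
      ¬ IsAutTransform Φ₁ Φ₂ ∧ ∀ Φ : CMType K, IsAutTransform Φ₁ Φ ∨ IsAutTransform Φ₂ Φ := by
  obtain ⟨hS₁, hS₂, hst₁, hst₂, hn⟩ := reps_eight
  obtain ⟨Φ₁, hr₁⟩ := exists_residueSet_eq₈ (K := K) hS₁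
  obtain ⟨Φ₂, hr₂⟩ := exists_residueSet_eq₈ (K := K) hS₂
  refine ⟨Φ₁, Φ₂, hr₁, hr₂, (stable_iff_pullback_eq₈ Φ₁ 3).2 (by rw [hr₁]; exact hst₁),
    (stable_iff_pullback_eq₈ Φ₂ 5).2 (by rw [hr₂]; exact hst₂),
    fun h ↦ hn (by simpa only [hr₁, hr₂] using (isAutTransform_iff_exists_eq_pullback 8 Φ₁ Φ₂).1 h), fun Φ ↦ ?_⟩
  rcases forall_exists_pullback_rep_eight _ (residueSet_mem₈ Φ) with h | h
  · exact Or.inl ((isAutTransform_iff_exists_eq_pullback 8 Φ₁ Φ).2 (by rw [hr₁]; exact h))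
  · exact Or.inr ((isAutTransform_iff_exists_eq_pullback 8 Φ₂ Φ).2 (by rw [hr₂]; exact h))

omit [IsCyclotomicExtension {8} ℚ K] in
/-- **`ℂ²/Φ(𝔞) ≅ ℂ²/Ψ(𝔟) ⟺ Φ, Ψ IN ONE FAMILY — all types of `ℚ(ζ₈)`, all ideals** (`h(ℚ(ζ₈)) = 1` and the lane's
`isIsomorphic_periodIso_iff_isAutTransform`). [cite: Shimura1998, §7.4 Prop. 17 p. 58, §8.4 (2) p. 73] [cite: Washington1997, Thm. 11.1] -/
theorem isIsomorphic_periodIso_iff_isAutTransform_eight (hK : IsCyclotomicExtension {8} ℚ K) (Φ Ψ : CMType K)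
    (I J : (FractionalIdeal (𝓞 K)⁰ K)ˣ) : IsIsomorphic (periodIso Φ I) (periodIso Ψ J) ↔ IsAutTransform Φ Ψ := by
  haveI : IsPrincipalIdealRing (𝓞 K) := (classNumber_eq_one_iff (K := K)).1 (classNumber_eq_one_of_isCyclotomicExtension_eight K hK)
  obtain ⟨ζ, hζ⟩ : ∃ ζ : K, IsPrimitiveRoot ζ 8 :=
    IsCyclotomicExtension.exists_isPrimitiveRoot ℚ K (Set.mem_singleton 8) (by norm_num)
  exact isIsomorphic_periodIso_iff_isAutTransform hζ Φ Ψ I J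

omit [IsCyclotomicExtension {8} ℚ K] in
/-- **… ⟺ `ℂ²/Φ(𝔞) ∼ ℂ²/Ψ(𝔟)`**: on the models of `ℚ(ζ₈)` «isomorphic» and «isogenous» coincide.
[cite: Shimura1998, §6.1 Cor. p. 41, §7.4 Prop. 17 p. 58] -/
theorem isIsomorphic_periodIso_iff_isIsogenous_eight (hK : IsCyclotomicExtension {8} ℚ K) (Φ Ψ : CMType K)
    (I J : (FractionalIdeal (𝓞 K)⁰ K)ˣ) :
    IsIsomorphic (periodIso Φ I) (periodIso Ψ J) ↔ IsIsogenous (periodIso Φ I) (periodIso Ψ J) := by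
  haveI : IsGalois ℚ K := IsCyclotomicExtension.isGalois {8} ℚ K
  rw [isIsomorphic_periodIso_iff_isAutTransform_eight hK, isIsogenous_periodIso_iff_isAutTransform]

omit [IsCyclotomicExtension {8} ℚ K] in
/-- **TWO MODELS, NON-ISOGENOUS**: CM types `Φ₁`, `Φ₂` of `ℚ(ζ₈)` (residue sets `{1, 3}`, `{1, 5}`: induced from `ℚ(√−2)`,
`ℚ(i)`) whose principal models `Xᵢ = ℂ²/Φᵢ(𝓞)` — both `∼ E²` for a CM elliptic curve `E`, neither simple — are NOT
ISOGENOUS, every model `ℂ²/Φ(𝔞)` being isomorphic to one of them. [cite: Shimura1998, §7.4 Prop. 17 p. 58, §8.4 Example (2)(A) p. 64]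
[cite: Washington1997, Thm. 11.1] -/
theorem exists_two_models_eight (hK : IsCyclotomicExtension {8} ℚ K) :
    ∃ Φ₁ Φ₂ : CMType K, residueSet 8 Φ₁ = {1, 3} ∧ residueSet 8 Φ₂ = {1, 5} ∧
      ¬ ComplexTorus.IsSimple (periodIso Φ₁ (1 : (FractionalIdeal (𝓞 K)⁰ K)ˣ)) ∧
      ¬ ComplexTorus.IsSimple (periodIso Φ₂ (1 : (FractionalIdeal (𝓞 K)⁰ K)ˣ)) ∧
      ¬ IsIsogenous (periodIso Φ₁ (1 : (FractionalIdeal (𝓞 K)⁰ K)ˣ)) (periodIso Φ₂ (1 : (FractionalIdeal (𝓞 K)⁰ K)ˣ)) ∧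
      ∀ (Φ : CMType K) (I : (FractionalIdeal (𝓞 K)⁰ K)ˣ),
        IsIsomorphic (periodIso Φ I) (periodIso Φ₁ (1 : (FractionalIdeal (𝓞 K)⁰ K)ˣ)) ∨
        IsIsomorphic (periodIso Φ I) (periodIso Φ₂ (1 : (FractionalIdeal (𝓞 K)⁰ K)ˣ)) := by
  haveI : IsGalois ℚ K := IsCyclotomicExtension.isGalois {8} ℚ K
  obtain ⟨Φ₁, Φ₂, hr₁, hr₂, -, -, h₁₂, hall⟩ := exists_two_families_eight hK
  set O := (1 : (FractionalIdeal (𝓞 K)⁰ K)ˣ) with hO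
  refine ⟨Φ₁, Φ₂, hr₁, hr₂, not_isSimple_periodIso_eight Φ₁ O, not_isSimple_periodIso_eight Φ₂ O,
    not_isIsogenous_periodIso_of_not_isAutTransform O O h₁₂, fun Φ I ↦ ?_⟩
  rcases hall Φ with h | h
  · exact Or.inl ((isIsomorphic_periodIso_iff_isAutTransform_eight hK Φ Φ₁ I O).2 h.symm)
  · exact Or.inr ((isIsomorphic_periodIso_iff_isAutTransform_eight hK Φ Φ₂ I O).2 h.symm)

end ModelsEight

/-! ### §2.2 The CM types and the models `ℂ²/Φ(𝔞)` of `ℚ(ζ₁₂)` -/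

section ModelsTwelve

variable {K : Type} [Field K] [NumberField K] [IsCyclotomicExtension {12} ℚ K]

/-- The residue set of a CM type of `ℚ(ζ₁₂)` is one of the `4` CM residue sets. [cite: Shimura1998, §8.4 Example (2)(A)] -/
private theorem residueSet_mem₁₂ (Φ : CMType K) : residueSet 12 Φ ∈ allCMResidueSets 12 :=
  (mem_allCMResidueSets_iff₃₉ _).2 (isCMResidueSet_residueSet 12 Φ)

/-- «`S_Φ` stable under `t`» in the membership spelling is `S_Φ·t⁻¹ = S_Φ`. [cite: Shimura1998, §8.4 Example (1)] -/
private theorem stable_iff_pullback_eq₁₂ (Φ : CMType K) (t : ZMod 12) :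
    (∀ c ∈ unitResidues 12, (c * t ∈ residueSet 12 Φ ↔ c ∈ residueSet 12 Φ)) ↔
      pullback 12 t (residueSet 12 Φ) = residueSet 12 Φ := by
  rw [eq_comm, ← forall_mem_iff_iff_eq_pullback (residueSet_subset_unitResidues 12 Φ) t]
  exact forall₂_congr fun c _ => Iff.comm

/-- The CM type with a prescribed CM residue set. [cite: Shimura1998, §8.4 Example (1)] -/
private theorem exists_residueSet_eq₁₂ {S : Finset (ZMod 12)} (hS : IsCMResidueSet 12 S) :
    ∃ Φ : CMType K, residueSet 12 Φ = S :=
  ⟨cmTypeOfResidues (L := K) S hS.cm, residueSet_cmTypeOfResidues 12 hS _⟩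

omit [IsCyclotomicExtension {12} ℚ K] in
/-- **`ℚ(ζ₁₂)` has `2² = 4` CM types, NONE of them primitive.** [cite: Shimura1998, §8.4 Example (2)(A), p. 64] -/
theorem natCard_cmType_and_not_isPrimitive_twelve (hK : IsCyclotomicExtension {12} ℚ K) (φ₀ : K →+* ℂ) :
    Nat.card (CMType K) = 4 ∧ ∀ Φ : CMType K, ¬ IsPrimitive (ℂ ≃+* ℂ) Φ.1 φ₀ := by
  haveI : IsCMField K := IsCyclotomicExtension.Rat.isCMField K (S := ({12} : Set ℕ)) ⟨12, rfl, by norm_num⟩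
  refine ⟨by rw [Literature.NumberTheory.ComplexMultiplication.CMTypeCount.natCard_cmType, finrank_eq_totient 12 K]; decide, fun Φ h ↦ ?_⟩
  have h0 := Finset.filter_eq_empty_iff.1 (Finset.card_eq_zero.1 card_allCMResidueSets_and_filter_twelve.2.2)
    (residueSet_mem₁₂ Φ)
  exact h0 ((isPrimitive_iff_hasTrivialStabilizer 12 Φ φ₀).1 h)

/-- **Every CM type of `ℚ(ζ₁₂)` is induced from EXACTLY ONE of `ℚ(i)`, `ℚ(√−3)`**: its residue set is stable under `5`
iff it is not stable under `7`. [cite: Shimura1998, §8.4 Example (2)(A), p. 64] -/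
theorem stable_iff_not_stable_twelve (Φ : CMType K) :
    (∀ c ∈ unitResidues 12, (c * 5 ∈ residueSet 12 Φ ↔ c ∈ residueSet 12 Φ)) ↔
      ¬(∀ c ∈ unitResidues 12, (c * 7 ∈ residueSet 12 Φ ↔ c ∈ residueSet 12 Φ)) := by
  have h := Finset.filter_eq_empty_iff.1 (Finset.card_eq_zero.1 card_allCMResidueSets_and_filter_twelve.2.1)
    (residueSet_mem₁₂ Φ)
  rw [not_not, ← stable_iff_pullback_eq₁₂, ← stable_iff_pullback_eq₁₂] at h
  exact h

/-- **THE FAMILIES OF `ℚ(ζ₁₂)`**: two CM types are transformed onto each other by an automorphism iff both or neither are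
induced from `ℚ(i)` (residue sets both or neither stable under `5`). [cite: Shimura1998, §8.4 Examples (1)–(2), p. 65] -/
theorem isAutTransform_iff_twelve (Φ Ψ : CMType K) :
    IsAutTransform Φ Ψ ↔
      ((∀ c ∈ unitResidues 12, (c * 5 ∈ residueSet 12 Φ ↔ c ∈ residueSet 12 Φ)) ↔
        (∀ c ∈ unitResidues 12, (c * 5 ∈ residueSet 12 Ψ ↔ c ∈ residueSet 12 Ψ))) := by
  rw [isAutTransform_iff_exists_eq_pullback 12 Φ Ψ,
    forall_exists_pullback_iff_twelve _ (residueSet_mem₁₂ Φ) _ (residueSet_mem₁₂ Ψ),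
    stable_iff_pullback_eq₁₂, stable_iff_pullback_eq₁₂]

omit [IsCyclotomicExtension {12} ℚ K] in
/-- **THE TWO FAMILIES OF CM TYPES OF `ℚ(ζ₁₂)`, EXPLICITLY**: types `Φ₁`, `Φ₂` with residue sets `{1, 5}` (stable under `5`:
induced from `ℚ(i)`) and `{1, 7}` (stable under `7`: from `ℚ(√−3)`), not transformed onto each other, every type a transform
of one of them. [cite: Shimura1998, §8.4 Example (2)(A), p. 64] -/
theorem exists_two_families_twelve (hK : IsCyclotomicExtension {12} ℚ K) :
    ∃ Φ₁ Φ₂ : CMType K, residueSet 12 Φ₁ = {1, 5} ∧ residueSet 12 Φ₂ = {1, 7} ∧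
      (∀ c ∈ unitResidues 12, (c * 5 ∈ residueSet 12 Φ₁ ↔ c ∈ residueSet 12 Φ₁)) ∧
      (∀ c ∈ unitResidues 12, (c * 7 ∈ residueSet 12 Φ₂ ↔ c ∈ residueSet 12 Φ₂)) ∧
      ¬ IsAutTransform Φ₁ Φ₂ ∧ ∀ Φ : CMType K, IsAutTransform Φ₁ Φ ∨ IsAutTransform Φ₂ Φ := by
  obtain ⟨hS₁, hS₂, hst₁, hst₂, hn⟩ := reps_twelve
  obtain ⟨Φ₁, hr₁⟩ := exists_residueSet_eq₁₂ (K := K) hS₁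
  obtain ⟨Φ₂, hr₂⟩ := exists_residueSet_eq₁₂ (K := K) hS₂
  refine ⟨Φ₁, Φ₂, hr₁, hr₂, (stable_iff_pullback_eq₁₂ Φ₁ 5).2 (by rw [hr₁]; exact hst₁),
    (stable_iff_pullback_eq₁₂ Φ₂ 7).2 (by rw [hr₂]; exact hst₂),
    fun h ↦ hn (by simpa only [hr₁, hr₂] using (isAutTransform_iff_exists_eq_pullback 12 Φ₁ Φ₂).1 h), fun Φ ↦ ?_⟩
  rcases forall_exists_pullback_rep_twelve _ (residueSet_mem₁₂ Φ) with h | h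
  · exact Or.inl ((isAutTransform_iff_exists_eq_pullback 12 Φ₁ Φ).2 (by rw [hr₁]; exact h))
  · exact Or.inr ((isAutTransform_iff_exists_eq_pullback 12 Φ₂ Φ).2 (by rw [hr₂]; exact h))

omit [IsCyclotomicExtension {12} ℚ K] in
/-- **`ℂ²/Φ(𝔞) ≅ ℂ²/Ψ(𝔟) ⟺ Φ, Ψ IN ONE FAMILY — all types of `ℚ(ζ₁₂)`, all ideals** (`h(ℚ(ζ₁₂)) = 1` and the lane's
`isIsomorphic_periodIso_iff_isAutTransform`). [cite: Shimura1998, §7.4 Prop. 17 p. 58, §8.4 (2) p. 73] [cite: Washington1997, Thm. 11.1] -/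
theorem isIsomorphic_periodIso_iff_isAutTransform_twelve (hK : IsCyclotomicExtension {12} ℚ K) (Φ Ψ : CMType K)
    (I J : (FractionalIdeal (𝓞 K)⁰ K)ˣ) : IsIsomorphic (periodIso Φ I) (periodIso Ψ J) ↔ IsAutTransform Φ Ψ := by
  haveI : IsPrincipalIdealRing (𝓞 K) := (classNumber_eq_one_iff (K := K)).1 (classNumber_eq_one_of_isCyclotomicExtension_twelve K hK)
  obtain ⟨ζ, hζ⟩ : ∃ ζ : K, IsPrimitiveRoot ζ 12 :=
    IsCyclotomicExtension.exists_isPrimitiveRoot ℚ K (Set.mem_singleton 12) (by norm_num)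
  exact isIsomorphic_periodIso_iff_isAutTransform hζ Φ Ψ I J

omit [IsCyclotomicExtension {12} ℚ K] in
/-- **… ⟺ `ℂ²/Φ(𝔞) ∼ ℂ²/Ψ(𝔟)`**: on the models of `ℚ(ζ₁₂)` «isomorphic» and «isogenous» coincide.
[cite: Shimura1998, §6.1 Cor. p. 41, §7.4 Prop. 17 p. 58] -/
theorem isIsomorphic_periodIso_iff_isIsogenous_twelve (hK : IsCyclotomicExtension {12} ℚ K) (Φ Ψ : CMType K)
    (I J : (FractionalIdeal (𝓞 K)⁰ K)ˣ) :
    IsIsomorphic (periodIso Φ I) (periodIso Ψ J) ↔ IsIsogenous (periodIso Φ I) (periodIso Ψ J) := by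
  haveI : IsGalois ℚ K := IsCyclotomicExtension.isGalois {12} ℚ K
  rw [isIsomorphic_periodIso_iff_isAutTransform_twelve hK, isIsogenous_periodIso_iff_isAutTransform]

omit [IsCyclotomicExtension {12} ℚ K] in
/-- **TWO MODELS, NON-ISOGENOUS**: CM types `Φ₁`, `Φ₂` of `ℚ(ζ₁₂)` (residue sets `{1, 5}`, `{1, 7}`: induced from `ℚ(i)`,
`ℚ(√−3)`) whose principal models `Xᵢ = ℂ²/Φᵢ(𝓞)` — both `∼ E²` for a CM elliptic curve `E`, neither simple — are NOT
ISOGENOUS, every model `ℂ²/Φ(𝔞)` being isomorphic to one of them. [cite: Shimura1998, §7.4 Prop. 17 p. 58, §8.4 Example (2)(A) p. 64]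
[cite: Washington1997, Thm. 11.1] -/
theorem exists_two_models_twelve (hK : IsCyclotomicExtension {12} ℚ K) :
    ∃ Φ₁ Φ₂ : CMType K, residueSet 12 Φ₁ = {1, 5} ∧ residueSet 12 Φ₂ = {1, 7} ∧
      ¬ ComplexTorus.IsSimple (periodIso Φ₁ (1 : (FractionalIdeal (𝓞 K)⁰ K)ˣ)) ∧
      ¬ ComplexTorus.IsSimple (periodIso Φ₂ (1 : (FractionalIdeal (𝓞 K)⁰ K)ˣ)) ∧
      ¬ IsIsogenous (periodIso Φ₁ (1 : (FractionalIdeal (𝓞 K)⁰ K)ˣ)) (periodIso Φ₂ (1 : (FractionalIdeal (𝓞 K)⁰ K)ˣ)) ∧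
      ∀ (Φ : CMType K) (I : (FractionalIdeal (𝓞 K)⁰ K)ˣ),
        IsIsomorphic (periodIso Φ I) (periodIso Φ₁ (1 : (FractionalIdeal (𝓞 K)⁰ K)ˣ)) ∨
        IsIsomorphic (periodIso Φ I) (periodIso Φ₂ (1 : (FractionalIdeal (𝓞 K)⁰ K)ˣ)) := by
  haveI : IsGalois ℚ K := IsCyclotomicExtension.isGalois {12} ℚ K
  obtain ⟨Φ₁, Φ₂, hr₁, hr₂, -, -, h₁₂, hall⟩ := exists_two_families_twelve hK
  set O := (1 : (FractionalIdeal (𝓞 K)⁰ K)ˣ) with hO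
  refine ⟨Φ₁, Φ₂, hr₁, hr₂, not_isSimple_periodIso_twelve Φ₁ O, not_isSimple_periodIso_twelve Φ₂ O,
    not_isIsogenous_periodIso_of_not_isAutTransform O O h₁₂, fun Φ I ↦ ?_⟩
  rcases hall Φ with h | h
  · exact Or.inl ((isIsomorphic_periodIso_iff_isAutTransform_twelve hK Φ Φ₁ I O).2 h.symm)
  · exact Or.inr ((isIsomorphic_periodIso_iff_isAutTransform_twelve hK Φ Φ₂ I O).2 h.symm)

end ModelsTwelve

/-! ### §3 The pairs `(X, u)` -/

section Pairs

variable {ι : Type} [Fintype ι] [DecidableEq ι] {E : Type} [NormedAddCommGroup E] [NormedSpace ℂ E]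
  {P : (ι → ℝ) ≃L[ℝ] E} {ι' : Type} [Fintype ι'] [DecidableEq ι'] {E' : Type} [NormedAddCommGroup E']
  [NormedSpace ℂ E'] {P' : (ι' → ℝ) ≃L[ℝ] E'}

/-- `8 = 2³` is a prime power. [folklore] -/
private theorem isPrimePow_eight₃₉ : IsPrimePow 8 :=
  (isPrimePow_nat_iff 8).2 ⟨2, 3, Nat.prime_two, by norm_num, by norm_num⟩

omit [DecidableEq ι] in
/-- Order `8` on a `2`-dimensional complex torus forces `P_u = Φ₈` (`8 = 2³`, `rk = 4 = φ(8)`; generation 31 FILE 2).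
[cite: BirkenhakeLange2004, §13.3] -/
private theorem charpoly_eq_cyclotomic_eight_of_orderOf₃₉ [DecidableEq ι] {A : Matrix ι ι ℤ} (hord : orderOf A = 8)
    (hdim : finrank ℂ E = 2) (P : (ι → ℝ) ≃L[ℝ] E) : A.charpoly = cyclotomic 8 ℤ :=
  charpoly_eq_cyclotomic_of_orderOf_eq_of_finrank P isPrimePow_eight₃₉ hord (by rw [hdim]; decide)

set_option backward.isDefEq.respectTransparency false in -- Mathlib's instance
-- `IsCyclotomicExtension {8} ℚ (CyclotomicField 8 ℚ)` is keyed on `CyclotomicField.algebra`, the goal on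
-- `DivisionRing.toRatAlgebra` (same workaround as generation 31 FILE 1 `isAbelianVariety_of_charpoly_eq_cyclotomic`)
/-- **TWO `2`-DIMENSIONAL COMPLEX TORI WITH AUTOMORPHISMS OF ORDER `8` ARE ISOMORPHIC IFF THEY ARE ISOGENOUS** (both mean: their
types lie in one family of `ℚ(ζ₈)`; `h(ℚ(ζ₈)) = 1`). [cite: Shimura1998, §6.1 Thm. 2 p. 41, §7.4 Prop. 17 p. 58] [cite: Washington1997, Thm. 11.1]
[cite: Fujiki1988, Thm. 4.1 and Table 6, pp. 45–46] -/
theorem isIsomorphic_iff_isIsogenous_of_orderOf_eq_eight {A : Matrix ι ι ℤ} (hA : A ∈ endRingInt P) (hord : orderOf A = 8)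
    (hdim : finrank ℂ E = 2) {A' : Matrix ι' ι' ℤ} (hA' : A' ∈ endRingInt P') (hord' : orderOf A' = 8)
    (hdim' : finrank ℂ E' = 2) : IsIsomorphic P P' ↔ IsIsogenous P P' := by
  haveI := isPrincipalIdealRing_ringOfIntegers_cyclotomicField_eight
  exact isIsomorphic_iff_isIsogenous_of_charpoly_eq_cyclotomic (IsCyclotomicExtension.zeta_spec 8 ℚ (CyclotomicField 8 ℚ))
    hA (charpoly_eq_cyclotomic_eight_of_orderOf₃₉ hord hdim P) hA' (charpoly_eq_cyclotomic_eight_of_orderOf₃₉ hord' hdim' P')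

set_option backward.isDefEq.respectTransparency false in -- see above
/-- **EXACTLY TWO COMPLEX TORI OF DIMENSION `2` ADMIT AN AUTOMORPHISM OF ORDER `8`.**  There are CM types `Φ₁, Φ₂` of `ℚ(ζ₈)`
(Mathlib's `CyclotomicField 8 ℚ`; residue sets `{1,3}` — induced from `ℚ(√−2)` — and `{1,5}` — induced from `ℚ(i)`) whose
principal models `Xᵢ = ℂ²/Φᵢ(𝓞)` — each carrying the automorphism `ζ₈` of order `8`, each isogenous to the square of a CM
elliptic curve, neither simple — are NOT ISOGENOUS (a fortiori not isomorphic), such that EVERY `2`-dimensional complex torus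
with an endomorphism of order `8` is isomorphic to `X₁` or to `X₂`: `h(ℚ(ζ₈)) · #(types mod automorphisms) = 1 · 2`.
[cite: Shimura1998, §6.1 Thm. 2 p. 41, §7.4 Prop. 17 p. 58, §8.4 Example (2)(A) p. 64] [cite: Fujiki1988, Thm. 4.1 and Table 6, pp. 45–46]
[cite: Washington1997, Thm. 11.1] -/
theorem exists_two_forall_isIsomorphic_of_orderOf_eq_eight :
    ∃ Φ₁ Φ₂ : CMType (CyclotomicField 8 ℚ),
      residueSet 8 Φ₁ = {1, 3} ∧ residueSet 8 Φ₂ = {1, 5} ∧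
      ¬ ComplexTorus.IsSimple (periodIso Φ₁ (1 : (FractionalIdeal (𝓞 (CyclotomicField 8 ℚ))⁰ (CyclotomicField 8 ℚ))ˣ)) ∧
      ¬ ComplexTorus.IsSimple (periodIso Φ₂ (1 : (FractionalIdeal (𝓞 (CyclotomicField 8 ℚ))⁰ (CyclotomicField 8 ℚ))ˣ)) ∧
      ¬ IsIsogenous (periodIso Φ₁ (1 : (FractionalIdeal (𝓞 (CyclotomicField 8 ℚ))⁰ (CyclotomicField 8 ℚ))ˣ))
          (periodIso Φ₂ (1 : (FractionalIdeal (𝓞 (CyclotomicField 8 ℚ))⁰ (CyclotomicField 8 ℚ))ˣ)) ∧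
      ∀ {ι : Type} [Fintype ι] [DecidableEq ι] {E : Type} [NormedAddCommGroup E] [NormedSpace ℂ E]
        (P : (ι → ℝ) ≃L[ℝ] E) {A : Matrix ι ι ℤ}, A ∈ endRingInt P → orderOf A = 8 → finrank ℂ E = 2 →
        IsIsomorphic P (periodIso Φ₁ (1 : (FractionalIdeal (𝓞 (CyclotomicField 8 ℚ))⁰ (CyclotomicField 8 ℚ))ˣ)) ∨
        IsIsomorphic P (periodIso Φ₂ (1 : (FractionalIdeal (𝓞 (CyclotomicField 8 ℚ))⁰ (CyclotomicField 8 ℚ))ˣ)) := by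
  have hζ := IsCyclotomicExtension.zeta_spec 8 ℚ (CyclotomicField 8 ℚ)
  obtain ⟨Φ₁, Φ₂, hr₁, hr₂, h₁, h₂, h₁₂, hall⟩ :=
    exists_two_models_eight (K := CyclotomicField 8 ℚ) (CyclotomicField.isCyclotomicExtension 8 ℚ)
  refine ⟨Φ₁, Φ₂, hr₁, hr₂, h₁, h₂, h₁₂, fun P A hA hord hdim ↦ ?_⟩
  obtain ⟨Φ, I, e, he, he₂, -⟩ :=
    exists_cmType_ideal_iso_of_charpoly_eq_cyclotomic hζ hA (charpoly_eq_cyclotomic_eight_of_orderOf₃₉ hord hdim P)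
  have hX : IsIsomorphic P (periodIso Φ I) := ⟨e, he, he₂⟩
  rcases hall Φ I with h | h
  · exact Or.inl (hX.trans h)
  · exact Or.inr (hX.trans h)

set_option backward.isDefEq.respectTransparency false in -- see above
/-- **TWO COMPLEX TORI WITH ENDOMORPHISMS OF CHARACTERISTIC POLYNOMIAL `Φ₁₂` ARE ISOMORPHIC IFF THEY ARE ISOGENOUS**
(`h(ℚ(ζ₁₂)) = 1`). [cite: Shimura1998, §6.1 Thm. 2 p. 41, §7.4 Prop. 17 p. 58] [cite: Washington1997, Thm. 11.1] -/
theorem isIsomorphic_iff_isIsogenous_of_charpoly_eq_cyclotomic_twelve {A : Matrix ι ι ℤ} (hA : A ∈ endRingInt P)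
    (hP : A.charpoly = cyclotomic 12 ℤ) {A' : Matrix ι' ι' ℤ} (hA' : A' ∈ endRingInt P')
    (hP' : A'.charpoly = cyclotomic 12 ℤ) : IsIsomorphic P P' ↔ IsIsogenous P P' := by
  haveI := isPrincipalIdealRing_ringOfIntegers_cyclotomicField_twelve
  exact isIsomorphic_iff_isIsogenous_of_charpoly_eq_cyclotomic (IsCyclotomicExtension.zeta_spec 12 ℚ (CyclotomicField 12 ℚ))
    hA hP hA' hP'

set_option backward.isDefEq.respectTransparency false in -- see above
/-- **EXACTLY TWO COMPLEX TORI ADMIT AN ENDOMORPHISM OF CHARACTERISTIC POLYNOMIAL `Φ₁₂`.**  There are CM types `Φ₁, Φ₂` of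
`ℚ(ζ₁₂)` (residue sets `{1,5}` — induced from `ℚ(i)` — and `{1,7}` — induced from `ℚ(√−3)`) whose principal models
`Xᵢ = ℂ²/Φᵢ(𝓞)` — each `∼ E²`, neither simple — are NOT ISOGENOUS, such that EVERY complex torus with an endomorphism of
characteristic polynomial `Φ₁₂` is isomorphic to `X₁` or to `X₂`. [cite: Shimura1998, §6.1 Thm. 2 p. 41, §7.4 Prop. 17 p. 58, §8.4 Example (2)(A) p. 64]
[cite: Fujiki1988, Thm. 4.1 and Table 6, pp. 45–46] [cite: Washington1997, Thm. 11.1] -/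
theorem exists_two_forall_isIsomorphic_of_charpoly_eq_cyclotomic_twelve :
    ∃ Φ₁ Φ₂ : CMType (CyclotomicField 12 ℚ),
      residueSet 12 Φ₁ = {1, 5} ∧ residueSet 12 Φ₂ = {1, 7} ∧
      ¬ ComplexTorus.IsSimple (periodIso Φ₁ (1 : (FractionalIdeal (𝓞 (CyclotomicField 12 ℚ))⁰ (CyclotomicField 12 ℚ))ˣ)) ∧
      ¬ ComplexTorus.IsSimple (periodIso Φ₂ (1 : (FractionalIdeal (𝓞 (CyclotomicField 12 ℚ))⁰ (CyclotomicField 12 ℚ))ˣ)) ∧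
      ¬ IsIsogenous (periodIso Φ₁ (1 : (FractionalIdeal (𝓞 (CyclotomicField 12 ℚ))⁰ (CyclotomicField 12 ℚ))ˣ))
          (periodIso Φ₂ (1 : (FractionalIdeal (𝓞 (CyclotomicField 12 ℚ))⁰ (CyclotomicField 12 ℚ))ˣ)) ∧
      ∀ {ι : Type} [Fintype ι] [DecidableEq ι] {E : Type} [NormedAddCommGroup E] [NormedSpace ℂ E]
        (P : (ι → ℝ) ≃L[ℝ] E) {A : Matrix ι ι ℤ}, A ∈ endRingInt P → A.charpoly = cyclotomic 12 ℤ →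
        IsIsomorphic P (periodIso Φ₁ (1 : (FractionalIdeal (𝓞 (CyclotomicField 12 ℚ))⁰ (CyclotomicField 12 ℚ))ˣ)) ∨
        IsIsomorphic P (periodIso Φ₂ (1 : (FractionalIdeal (𝓞 (CyclotomicField 12 ℚ))⁰ (CyclotomicField 12 ℚ))ˣ)) := by
  have hζ := IsCyclotomicExtension.zeta_spec 12 ℚ (CyclotomicField 12 ℚ)
  obtain ⟨Φ₁, Φ₂, hr₁, hr₂, h₁, h₂, h₁₂, hall⟩ :=
    exists_two_models_twelve (K := CyclotomicField 12 ℚ) (CyclotomicField.isCyclotomicExtension 12 ℚ)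
  refine ⟨Φ₁, Φ₂, hr₁, hr₂, h₁, h₂, h₁₂, fun P A hA hP ↦ ?_⟩
  obtain ⟨Φ, I, e, he, he₂, -⟩ := exists_cmType_ideal_iso_of_charpoly_eq_cyclotomic hζ hA hP
  have hX : IsIsomorphic P (periodIso Φ I) := ⟨e, he, he₂⟩
  rcases hall Φ I with h | h
  · exact Or.inl (hX.trans h)
  · exact Or.inr (hX.trans h)

end Pairs

end ComplexTorus

end Literature.Geometry.Kaehler

end
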